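import Summits.QuantumFields.YangMills.Theorems.ParabolicTrajectoryTunedSequenceExistsSplitDefs
import Literature.MathematicalPhysics.QuantumFieldTheory.ActionDensityTimeReflection

/-!
# `TunedSequenceExists` (stmt-QuantumFields-10524), line `fixed-aspect-window`:
# the two RP-diagonal halves of (A) as NAMED statements (lead c4 reshape, 2026-08-17)

`P = r.curvature.F` straddles two time slices, so `⟨P ; τ_D P⟩` is not reflection-diagonal
(`Cruxes/…/RPStraddleCounterexample.lean`).  With the MIRROR corner density `Pᴿ := P ∘ cfgReflect`
(electric plaquettes read one step down, `ActionDensityTimeReflection.actionDensity_cfgReflect`) the two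
mirror correlators `⟨P ; τ_D Pᴿ⟩`, `⟨Pᴿ ; τ_D P⟩` ARE (`= Cov(F∘Θ, F) ≥ 0`, odd-torus reflection
positivity), and `⟨P ; τ_D P⟩² ≤ ⟨P ; τ Pᴿ⟩ · ⟨Pᴿ ; τ P⟩` at lags within one of `D`
(`Theorems/ParabolicTrajectoryTunedSequenceExistsMirrorBound.lean`, which proves
(A) ⟸ (A_in) ∧ (A_out): `MirrorBound.canonicalUpperBound_of_mirror`, stated there with the bodies
written out).  The statements below are the bodies of the reshaped line's stubs `stub_mirrorBoundIn` /
`stub_mirrorBoundOut` (skeleton `Cruxes/TunedSequenceExists/Lines/fixed_aspect_window.lean`);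
obligation pieces of the crux, not published facts.  References: Osterwalder–Seiler 1978 §2.
-/

noncomputable section

open Literature.MathematicalPhysics.QuantumFieldTheory Literature.MathematicalPhysics.QuantumLattice

namespace Summit.QuantumFields.YangMills.Theorems.TunedSequenceExists.FixedAspectSplit

section Mirror

variable {G : Type} [Group G] [TopologicalSpace G] [IsTopologicalGroup G] [CompactSpace G]
  [MeasurableSpace G] [BorelSpace G]

/-- **(A_in) Canonical upper bound for the INWARD mirror correlator** `⟨P ; τ_D Pᴿ⟩` (corner at `0`,
electric plaquettes on `0 → 1`; mirror corner at `D`, electric plaquettes on `D-1 → D`):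
`D⁸ |⟨P ; τ_D Pᴿ⟩_{β,2L+1}| ≤ K` for `β ≥ β₁`, all `L`, all `D ≤ L`.  Stub `stub_mirrorBoundIn`. -/
def MirrorBoundIn (r : LatticeRep G) : Prop :=
  ∃ (β₁ K : ℝ), ∀ β : ℝ, β₁ ≤ β → ∀ (L D : ℕ), D ≤ L →
    (D : ℝ) ^ 8 * |latticeConnectedCorr r.ρ β (2 * L + 1) r.curvature.F
      (fun V => r.curvature.F (cfgReflect V)) D| ≤ K

/-- **(A_out) Canonical upper bound for the OUTWARD mirror correlator** `⟨Pᴿ ; τ_D P⟩` (mirror corner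
at `0`, electric plaquettes on `-1 → 0`; corner at `D`, electric plaquettes on `D → D+1`):
`D⁸ |⟨Pᴿ ; τ_D P⟩_{β,2L+1}| ≤ K` for `β ≥ β₁`, all `L`, all `D ≤ L`.  Stub `stub_mirrorBoundOut`. -/
def MirrorBoundOut (r : LatticeRep G) : Prop :=
  ∃ (β₁ K : ℝ), ∀ β : ℝ, β₁ ≤ β → ∀ (L D : ℕ), D ≤ L →
    (D : ℝ) ^ 8 * |latticeConnectedCorr r.ρ β (2 * L + 1)
      (fun V => r.curvature.F (cfgReflect V)) r.curvature.F D| ≤ K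

/-- (A_in) at fixed data IS the shape of (A) applied to the inward mirror correlator (definitional):
like (A) it is inhabited by the zero table (`canonicalUpperBoundShape_zero`), so it is not ≥ the core. -/
theorem mirrorBoundIn_iff_shape (r : LatticeRep G) :
    MirrorBoundIn r ↔ CanonicalUpperBoundShape (fun β L D =>
      latticeConnectedCorr r.ρ β (2 * L + 1) r.curvature.F
        (fun V => r.curvature.F (cfgReflect V)) D) :=
  Iff.rfl

/-- (A_out) at fixed data IS the shape of (A) applied to the outward mirror correlator (definitional). -/
theorem mirrorBoundOut_iff_shape (r : LatticeRep G) :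
    MirrorBoundOut r ↔ CanonicalUpperBoundShape (fun β L D =>
      latticeConnectedCorr r.ρ β (2 * L + 1) (fun V => r.curvature.F (cfgReflect V))
        r.curvature.F D) :=
  Iff.rfl

end Mirror

/-- (A_in) under the crux's quantifier prefix (registered stub `stub_mirrorBoundIn`, verbatim body). -/
def MirrorBoundInAll : Prop :=
  ∀ (G : Type) [Group G] [TopologicalSpace G] [IsTopologicalGroup G] [CompactSpace G],
    IsCompactSimpleLieGroup G → letI : MeasurableSpace G := borel G
    haveI : BorelSpace G := ⟨rfl⟩
    ∀ (r : LatticeRep G), MirrorBoundIn r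

/-- (A_out) under the crux's quantifier prefix (registered stub `stub_mirrorBoundOut`, verbatim body). -/
def MirrorBoundOutAll : Prop :=
  ∀ (G : Type) [Group G] [TopologicalSpace G] [IsTopologicalGroup G] [CompactSpace G],
    IsCompactSimpleLieGroup G → letI : MeasurableSpace G := borel G
    haveI : BorelSpace G := ⟨rfl⟩
    ∀ (r : LatticeRep G), MirrorBoundOut r

end Summit.QuantumFields.YangMills.Theorems.TunedSequenceExists.FixedAspectSplit

end
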